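import Summits.AtomisticToContinuum.Crystallization.Theorems.ShellsToBarlowChart.Negative.Calibration
import Literature.Geometry.DiscreteGeometry.LayerStackings
import Literature.MathematicalPhysics.StatisticalMechanics.BarlowRings
import Mathlib.Analysis.Normed.Affine.MazurUlam

/-!
# Isometries of finite order of an ideal Barlow stacking move some site by graph distance `≤ 2`

Helper file T of stub `stub_powerTranslation` (line `develop-the-model-growth-descent`, crux
`ShellsToBarlowChart`, stmt-AtomisticToContinuum-9227), on the MODEL
`B = barlowStacking 1 √(2/3) s` only:

* `pt_near_two` — two sites at Euclidean distance `< 2` coincide, touch, or have a common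
  contact (the distances `< 2` of the ideal stacking are `1, √2, √(8/3), √3, √(11/3)`; integer
  enumeration of the distance form `12·dist² = 3(2P+Q+Λ)² + (3Q+Λ)² + 8K²` of
  `BarlowCoordination.lean`, witnesses checked by `decide`);
* `pt_exists_site_near` — covering radius `< 1` (`LayerStackings.exists_dist_barlowPos_lt_two`
  rescaled);
* `isometry_finiteOrder_shortMove` — an isometry of `ℝ³` mapping `B` into itself and of finite
  order fixes the centroid of an orbit, hence moves the nearest site by `< 2`, i.e. by graph
  distance `≤ 2`.
-/

noncomputable section

namespace Summit.AtomisticToContinuum.Crystallization.Theorems.PalmUnimodularRigidityShellsToBarlowChart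

open Literature.Geometry.DiscreteGeometry Literature.MathematicalPhysics.StatisticalMechanics
open Summit.AtomisticToContinuum.Crystallization.Theorems.ShellsToBarlowChartNegative

/-- Euclidean `3`-space. -/
local notation "E3" => EuclideanSpace ℝ (Fin 3)

/-! ## Integer enumeration: short vectors of the stacking have graph length `≤ 2` -/

/-- Same layer (`K = 0`, `Λ = 0`): form `< 48` means equal, touching, or two in-layer steps.
[folklore] -/
theorem pt_int_K0 (P Q : ℤ) (h : 3 * (2 * P + Q + 0) ^ 2 + (3 * Q + 0) ^ 2 < 48) :
    (P = 0 ∧ Q = 0) ∨ (P, Q) ∈ sixOffsets ∨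
      ∃ pq ∈ sixOffsets, (P - pq.1, Q - pq.2) ∈ sixOffsets := by
  have hP : P ^ 2 < 3 ^ 2 := by nlinarith [sq_nonneg (2 * Q + P)]
  have hQ : Q ^ 2 < 3 ^ 2 := by nlinarith [sq_nonneg (2 * P + Q)]
  obtain ⟨hP1, hP2⟩ := abs_lt_of_sq_lt_sq' hP (by norm_num)
  obtain ⟨hQ1, hQ2⟩ := abs_lt_of_sq_lt_sq' hQ (by norm_num)
  revert h
  interval_cases P <;> interval_cases Q <;> decide

/-- Adjacent layers (`|K| = 1`, letter `μ = ±1`): form `< 48` means touching, or an in-layer step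
followed or preceded by an inter-layer step. [folklore] -/
theorem pt_int_K1 (μ : ℤ) (hμ : μ = 1 ∨ μ = -1) (P Q : ℤ)
    (h : 3 * (2 * P + Q + μ) ^ 2 + (3 * Q + μ) ^ 2 + 8 < 48) :
    (P, Q) ∈ threeOffsets μ ∨
      (∃ pq ∈ threeOffsets μ, (P - pq.1, Q - pq.2) ∈ sixOffsets) ∨
        ∃ pq ∈ sixOffsets, (P - pq.1, Q - pq.2) ∈ threeOffsets μ := by
  have hQ : (3 * Q + μ) ^ 2 < 7 ^ 2 := by nlinarith [sq_nonneg (2 * P + Q + μ)]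
  have hP : (2 * P + Q + μ) ^ 2 < 4 ^ 2 := by nlinarith [sq_nonneg (3 * Q + μ)]
  obtain ⟨hQ1, hQ2⟩ := abs_lt_of_sq_lt_sq' hQ (by norm_num)
  obtain ⟨hP1, hP2⟩ := abs_lt_of_sq_lt_sq' hP (by norm_num)
  revert h
  rcases hμ with rfl | rfl
  · have hQ3 : -2 ≤ Q := by omega
    have hQ4 : Q ≤ 2 := by omega
    have hP3 : -4 ≤ P := by omega
    have hP4 : P ≤ 3 := by omega
    interval_cases P <;> interval_cases Q <;> decide
  · have hQ3 : -2 ≤ Q := by omega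
    have hQ4 : Q ≤ 2 := by omega
    have hP3 : -3 ≤ P := by omega
    have hP4 : P ≤ 4 := by omega
    interval_cases P <;> interval_cases Q <;> decide

/-- Two layers apart (`|K| = 2`, letters `μ₀, μ₁` of the two steps, `Λ = μ₀ + μ₁`): form `< 48`
means two consecutive inter-layer steps through the middle layer. [folklore] -/
theorem pt_int_K2 (μ₀ μ₁ : ℤ) (h0 : μ₀ = 1 ∨ μ₀ = -1) (h1 : μ₁ = 1 ∨ μ₁ = -1) (P Q : ℤ)
    (h : 3 * (2 * P + Q + (μ₀ + μ₁)) ^ 2 + (3 * Q + (μ₀ + μ₁)) ^ 2 + 32 < 48) :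
    ∃ pq ∈ threeOffsets μ₁, (P - pq.1, Q - pq.2) ∈ threeOffsets μ₀ := by
  have hQ : (3 * Q + (μ₀ + μ₁)) ^ 2 < 4 ^ 2 := by nlinarith [sq_nonneg (2 * P + Q + (μ₀ + μ₁))]
  have hP : (2 * P + Q + (μ₀ + μ₁)) ^ 2 < 3 ^ 2 := by nlinarith [sq_nonneg (3 * Q + (μ₀ + μ₁))]
  obtain ⟨hQ1, hQ2⟩ := abs_lt_of_sq_lt_sq' hQ (by norm_num)
  obtain ⟨hP1, hP2⟩ := abs_lt_of_sq_lt_sq' hP (by norm_num)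
  revert h
  rcases h0 with rfl | rfl <;> rcases h1 with rfl | rfl
  all_goals
    have hQ3 : -2 ≤ Q := by omega
    have hQ4 : Q ≤ 2 := by omega
    have hP3 : -3 ≤ P := by omega
    have hP4 : P ≤ 3 := by omega
    interval_cases P <;> interval_cases Q <;> decide


/-! ## Sites at distance `< 2` are at graph distance `≤ 2` -/

/-- **Two sites of the ideal stacking at distance `< 2` coincide, touch, or have a common
contact** (the distances below `2` are `1`, `√2`, `√(8/3)`, `√3`, `√(11/3)`, realised by octahedron
diagonals, second-layer and in-layer second neighbours). [folklore] -/
theorem pt_near_two {s : ℤ → ℤ} (hs : IsHaggSeq s) {b b' : E3}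
    (hb : b ∈ barlowStacking 1 (Real.sqrt (2 / 3)) s) (hb' : b' ∈ barlowStacking 1 (Real.sqrt (2 / 3)) s)
    (hlt : dist b b' < 2) :
    b = b' ∨ dist b b' = 1 ∨
      ∃ r ∈ barlowStacking 1 (Real.sqrt (2 / 3)) s, dist b r = 1 ∧ dist r b' = 1 := by
  obtain ⟨k, i, j, rfl⟩ := hb
  obtain ⟨k', i', j', rfl⟩ := hb'
  have hsq : Real.sqrt (2 / 3) ^ 2 = 2 / 3 * (1 : ℝ) ^ 2 := by rw [Real.sq_sqrt (by norm_num)]; norm_num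
  have hd := dist_barlowPos_eq_iff (a := 1) (h := Real.sqrt (2 / 3)) hs one_pos hsq
  have h12 := twelve_mul_dist_barlowPos_sq hsq s k i j k' i' j'
  set Λ : ℤ := haggLabel s k - haggLabel s k' with hΛ
  have hF : 3 * (2 * (i - i') + (j - j') + Λ) ^ 2 + (3 * (j - j') + Λ) ^ 2 + 8 * (k - k') ^ 2 < 48 := by
    have hd0 : 0 ≤ dist (barlowPos 1 (Real.sqrt (2 / 3)) s k i j)
        (barlowPos 1 (Real.sqrt (2 / 3)) s k' i' j') := dist_nonneg
    have hsq4 : dist (barlowPos 1 (Real.sqrt (2 / 3)) s k i j)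
        (barlowPos 1 (Real.sqrt (2 / 3)) s k' i' j') ^ 2 < 4 := by nlinarith
    have : ((3 * (2 * (i - i') + (j - j') + Λ) ^ 2 + (3 * (j - j') + Λ) ^ 2 +
        8 * (k - k') ^ 2 : ℤ) : ℝ) < 48 := by rw [one_pow, one_mul] at h12; linarith
    exact_mod_cast this
  have hK : (k - k') ^ 2 < 3 ^ 2 := by
    nlinarith [sq_nonneg (2 * (i - i') + (j - j') + Λ), sq_nonneg (3 * (j - j') + Λ)]
  obtain ⟨hK1, hK2⟩ := abs_lt_of_sq_lt_sq' hK (by norm_num)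
  -- in-layer witnesses: `r = barlowPos k₀ (i' + p) (j' + q)`
  have eoff : ∀ p q : ℤ, (i - (i' + p), j - (j' + q)) = (i - i' - p, j - j' - q) := by
    intro p q; rw [← sub_sub, ← sub_sub]
  have eoff' : ∀ p q : ℤ, (i' + p - i', j' + q - j') = (p, q) := by
    intro p q; rw [add_sub_cancel_left, add_sub_cancel_left]
  rcases (show k = k' ∨ k' = k + 1 ∨ k' = k - 1 ∨ k' = k + 2 ∨ k' = k - 2 by omega) with
    rfl | rfl | rfl | rfl | rfl
  · -- same layer
    have hΛ0 : Λ = 0 := by rw [hΛ, sub_self]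
    rw [hΛ0, sub_self] at hF
    have hF' : 3 * (2 * (i - i') + (j - j') + 0) ^ 2 + (3 * (j - j') + 0) ^ 2 < 48 := by linarith
    rcases pt_int_K0 _ _ hF' with ⟨hP, hQ⟩ | hm | ⟨⟨p, q⟩, hpq, hm⟩
    · left
      rw [sub_eq_zero.1 hP, sub_eq_zero.1 hQ]
    · exact Or.inr (Or.inl ((hd k i j k i' j').2 (Or.inl ⟨rfl, hm⟩)))
    · refine Or.inr (Or.inr ⟨barlowPos 1 (Real.sqrt (2 / 3)) s k (i' + p) (j' + q),
        barlowPos_mem _ _ _, ?_, ?_⟩)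
      · exact (hd k i j k _ _).2 (Or.inl ⟨rfl, by rw [eoff]; exact hm⟩)
      · exact (hd k _ _ k i' j').2 (Or.inl ⟨rfl, by rw [eoff']; exact hpq⟩)
  · -- next layer: `Λ = -s k`
    have hΛ' : Λ = -s k := by rw [hΛ, haggLabel_sub_haggLabel_succ]
    have hμ : -s k = 1 ∨ -s k = -1 := by rcases hs k with h | h <;> omega
    have hF' : 3 * (2 * (i - i') + (j - j') + -s k) ^ 2 + (3 * (j - j') + -s k) ^ 2 + 8 < 48 := by
      rw [hΛ'] at hF; nlinarith
    rcases pt_int_K1 _ hμ _ _ hF' with hm | ⟨⟨p, q⟩, hpq, hm⟩ | ⟨⟨p, q⟩, hpq, hm⟩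
    · exact Or.inr (Or.inl ((hd k i j _ i' j').2 (Or.inr (Or.inl ⟨rfl, hm⟩))))
    · refine Or.inr (Or.inr ⟨barlowPos 1 (Real.sqrt (2 / 3)) s k (i' + p) (j' + q),
        barlowPos_mem _ _ _, ?_, ?_⟩)
      · exact (hd k i j k _ _).2 (Or.inl ⟨rfl, by rw [eoff]; exact hm⟩)
      · exact (hd k _ _ _ i' j').2 (Or.inr (Or.inl ⟨rfl, by rw [eoff']; exact hpq⟩))
    · refine Or.inr (Or.inr ⟨barlowPos 1 (Real.sqrt (2 / 3)) s (k + 1) (i' + p) (j' + q),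
        barlowPos_mem _ _ _, ?_, ?_⟩)
      · exact (hd k i j _ _ _).2 (Or.inr (Or.inl ⟨rfl, by rw [eoff]; exact hm⟩))
      · exact (hd _ _ _ _ i' j').2 (Or.inl ⟨rfl, by rw [eoff']; exact hpq⟩)
  · -- previous layer: `Λ = s (k - 1)`
    have hΛ' : Λ = s (k - 1) := by rw [hΛ, haggLabel_sub_haggLabel_pred]
    have hF' : 3 * (2 * (i - i') + (j - j') + s (k - 1)) ^ 2 + (3 * (j - j') + s (k - 1)) ^ 2 + 8 <
        48 := by
      rw [hΛ'] at hF; nlinarith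
    rcases pt_int_K1 _ (hs (k - 1)) _ _ hF' with hm | ⟨⟨p, q⟩, hpq, hm⟩ | ⟨⟨p, q⟩, hpq, hm⟩
    · exact Or.inr (Or.inl ((hd k i j _ i' j').2 (Or.inr (Or.inr ⟨rfl, hm⟩))))
    · refine Or.inr (Or.inr ⟨barlowPos 1 (Real.sqrt (2 / 3)) s k (i' + p) (j' + q),
        barlowPos_mem _ _ _, ?_, ?_⟩)
      · exact (hd k i j k _ _).2 (Or.inl ⟨rfl, by rw [eoff]; exact hm⟩)
      · exact (hd k _ _ _ i' j').2 (Or.inr (Or.inr ⟨rfl, by rw [eoff']; exact hpq⟩))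
    · refine Or.inr (Or.inr ⟨barlowPos 1 (Real.sqrt (2 / 3)) s (k - 1) (i' + p) (j' + q),
        barlowPos_mem _ _ _, ?_, ?_⟩)
      · exact (hd k i j _ _ _).2 (Or.inr (Or.inr ⟨rfl, by rw [eoff]; exact hm⟩))
      · exact (hd _ _ _ _ i' j').2 (Or.inl ⟨rfl, by rw [eoff']; exact hpq⟩)
  · -- two layers up: `Λ = -(s k + s (k + 1))`
    have hΛ' : Λ = -s k + -s (k + 1) := by
      rw [hΛ, show k + 2 = k + 1 + 1 by ring, haggLabel_succ, haggLabel_succ]; ring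
    have hμ0 : -s k = 1 ∨ -s k = -1 := by rcases hs k with h | h <;> omega
    have hμ1 : -s (k + 1) = 1 ∨ -s (k + 1) = -1 := by rcases hs (k + 1) with h | h <;> omega
    have hF' : 3 * (2 * (i - i') + (j - j') + (-s k + -s (k + 1))) ^ 2 +
        (3 * (j - j') + (-s k + -s (k + 1))) ^ 2 + 32 < 48 := by
      rw [hΛ'] at hF; nlinarith
    obtain ⟨⟨p, q⟩, hpq, hm⟩ := pt_int_K2 _ _ hμ0 hμ1 _ _ hF'
    refine Or.inr (Or.inr ⟨barlowPos 1 (Real.sqrt (2 / 3)) s (k + 1) (i' + p) (j' + q),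
      barlowPos_mem _ _ _, ?_, ?_⟩)
    · exact (hd k i j _ _ _).2 (Or.inr (Or.inl ⟨rfl, by rw [eoff]; exact hm⟩))
    · exact (hd _ _ _ _ i' j').2 (Or.inr (Or.inl ⟨by ring, by rw [eoff']; exact hpq⟩))
  · -- two layers down: `Λ = s (k - 1) + s (k - 2)`
    have hΛ' : Λ = s (k - 1) + s (k - 2) := by
      have e1 := haggLabel_succ s (k - 2)
      have e2 := haggLabel_succ s (k - 1)
      rw [show k - 2 + 1 = k - 1 by ring] at e1
      rw [sub_add_cancel] at e2
      rw [hΛ]; linarith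
    have hF' : 3 * (2 * (i - i') + (j - j') + (s (k - 1) + s (k - 2))) ^ 2 +
        (3 * (j - j') + (s (k - 1) + s (k - 2))) ^ 2 + 32 < 48 := by
      rw [hΛ'] at hF; nlinarith
    obtain ⟨⟨p, q⟩, hpq, hm⟩ := pt_int_K2 _ _ (hs (k - 1)) (hs (k - 2)) _ _ hF'
    refine Or.inr (Or.inr ⟨barlowPos 1 (Real.sqrt (2 / 3)) s (k - 1) (i' + p) (j' + q),
      barlowPos_mem _ _ _, ?_, ?_⟩)
    · exact (hd k i j _ _ _).2 (Or.inr (Or.inr ⟨rfl, by rw [eoff]; exact hm⟩))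
    · refine (hd _ _ _ _ i' j').2 (Or.inr (Or.inr ⟨by ring, ?_⟩))
      rw [eoff', show k - 1 - 1 = k - 2 by ring]; exact hpq


/-! ## Covering radius, fixed points of finite-order isometries, and the short move -/

/-- **Covering radius of the model is `< 1`**: every point of `ℝ³` is within distance `< 1` of a
site (`exists_dist_barlowPos_lt_two` at scale `2`, halved). [folklore] -/
theorem pt_exists_site_near (s : ℤ → ℤ) (x : E3) :
    ∃ b ∈ barlowStacking 1 (Real.sqrt (2 / 3)) s, dist x b < 1 := by
  obtain ⟨k, i, j, h⟩ := exists_dist_barlowPos_lt_two s ((2 : ℝ) • x)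
  refine ⟨barlowPos 1 (Real.sqrt (2 / 3)) s k i j, barlowPos_mem _ _ _, ?_⟩
  have e : (2 : ℝ) • barlowPos 1 (Real.sqrt (2 / 3)) s k i j = barlowPos 2 layerSpacing s k i j := by
    rw [smul_barlowPos, mul_one]; rfl
  rw [← e, dist_smul₀, Real.norm_two] at h
  linarith

/-- Mazur–Ulam at the origin: `g z = L z + g 0` with `L` the linear part of `g`. [folklore] -/
theorem ptT_isometryEquiv_apply_eq (g : E3 ≃ᵢ E3) (z : E3) :
    g z = g.toRealAffineIsometryEquiv.linearIsometryEquiv z + g 0 := by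
  have h := g.toRealAffineIsometryEquiv.map_vsub z 0
  simp only [IsometryEquiv.coeFn_toRealAffineIsometryEquiv, vsub_eq_sub, sub_zero] at h
  rw [h, sub_add_cancel]

/-- **An isometry of finite order has a fixed point**: the centroid of an orbit. [folklore] -/
theorem pt_exists_fixedPoint (g : E3 ≃ᵢ E3) {n : ℕ} (hn : 1 ≤ n) (hg : g ^ n = 1) :
    ∃ c : E3, g c = c := by
  set L := g.toRealAffineIsometryEquiv.linearIsometryEquiv with hL
  set f : ℕ → E3 := fun m => (g ^ m) 0 with hf
  refine ⟨(n : ℝ)⁻¹ • ∑ m ∈ Finset.range n, f m, ?_⟩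
  have hn0 : (n : ℝ) ≠ 0 := by exact_mod_cast (show n ≠ 0 by omega)
  have hstep : ∀ m, g (f m) = f (m + 1) := fun m => by
    simp only [hf, pow_succ', IsometryEquiv.mul_apply]
  have hshift : ∑ m ∈ Finset.range n, f (m + 1) = ∑ m ∈ Finset.range n, f m := by
    have h1 := Finset.sum_range_succ f n
    have h2 := Finset.sum_range_succ' f n
    have hfn : f n = f 0 := by simp [hf, hg]
    rw [hfn, h2] at h1
    exact add_right_cancel h1
  calc g ((n : ℝ)⁻¹ • ∑ m ∈ Finset.range n, f m)
      = L ((n : ℝ)⁻¹ • ∑ m ∈ Finset.range n, f m) + g 0 := ptT_isometryEquiv_apply_eq g _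
    _ = (n : ℝ)⁻¹ • ∑ m ∈ Finset.range n, (L (f m) + g 0) := by
        rw [map_smul, map_sum, Finset.sum_add_distrib, Finset.sum_const, Finset.card_range,
          smul_add, ← Nat.cast_smul_eq_nsmul ℝ, smul_smul, inv_mul_cancel₀ hn0, one_smul]
    _ = (n : ℝ)⁻¹ • ∑ m ∈ Finset.range n, f (m + 1) := by
        congr 1
        refine Finset.sum_congr rfl fun m _ => ?_
        rw [← hstep, ptT_isometryEquiv_apply_eq g (f m)]
    _ = (n : ℝ)⁻¹ • ∑ m ∈ Finset.range n, f m := by rw [hshift]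

/-- **An isometry of `ℝ³` of finite order mapping the ideal stacking into itself moves some site
by graph distance `≤ 2`**: it fixes the centroid of an orbit, the nearest site `b` is within
`1` of it, so `dist b (g b) < 2`. [folklore] -/
theorem isometry_finiteOrder_shortMove : ∀ s : ℤ → ℤ, IsHaggSeq s → ∀ g : EuclideanSpace ℝ (Fin 3) ≃ᵢ EuclideanSpace ℝ (Fin 3), (∀ p ∈ barlowStacking 1 (Real.sqrt (2 / 3)) s, g p ∈ barlowStacking 1 (Real.sqrt (2 / 3)) s) → ∀ n : ℕ, 1 ≤ n → g ^ n = 1 → ∃ p ∈ barlowStacking 1 (Real.sqrt (2 / 3)) s, g p = p ∨ dist p (g p) = 1 ∨ ∃ r ∈ barlowStacking 1 (Real.sqrt (2 / 3)) s, dist p r = 1 ∧ dist r (g p) = 1 := by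
  intro s hs g hg n hn hgn
  obtain ⟨c, hc⟩ := pt_exists_fixedPoint g hn hgn
  obtain ⟨b, hb, hcb⟩ := pt_exists_site_near s c
  refine ⟨b, hb, ?_⟩
  have hlt : dist b (g b) < 2 := by
    calc dist b (g b) ≤ dist b c + dist c (g b) := dist_triangle _ _ _
      _ = dist c b + dist (g c) (g b) := by rw [dist_comm, hc]
      _ = dist c b + dist c b := by rw [g.dist_eq]
      _ < 2 := by linarith
  rcases pt_near_two hs hb (hg b hb) hlt with h | h | h
  · exact Or.inl h.symm
  · exact Or.inr (Or.inl h)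
  · exact Or.inr (Or.inr h)

end Summit.AtomisticToContinuum.Crystallization.Theorems.PalmUnimodularRigidityShellsToBarlowChart

end
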